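import Summits.CriticalPhenomena.PercolationContinuityZ3.Theorems.SahiMasterFamilyTensorisation
import Summits.CriticalPhenomena.PercolationContinuityZ3.Theorems.PercNearOneGluingNoHeavyLowerTailSahiMeetTowerAllOrders

/-!
# The BLOCK STRATUM of the master-family induction on `k`, sharp orders: only the orders of the two groups enter

Companion of `SahiMasterFamilyTensorisation.lean` (crux `NoHeavyLowerTail`, stmt-CriticalPhenomena-4575; cell `prim-masterthm`, seat P4, unit
`prim-masterthm-p4-g3`).  There, `sahiE_prod_blocks_nonneg` asked for Sahi positivity of ALL orders `≤ n + 1` of both marginal laws.  Here the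
orders are sharpened to what the law of total cumulance really uses: for a family of `n + 1` slots on `γ × β` split into a group `I = {i : b i}` of slots
depending on `x` only and the complementary group `J` depending on `y` only,

  `sahiE_prod_blocks_nonneg_sharp`:  `(∀ L ≤ |I|, SahiPositive μ L) → (∀ L ≤ |J|, SahiPositive ν L) → E^{μ⊗ν}_{n+1} ≥ 0`

(`μ, ν` nonnegative probability weights on preorders, slots nonnegative monotone).  So this is a genuine `k → k+1` step: GIVEN Sahi positivity of all
orders `< k` (on the marginals), every `k`-family splitting into two independent nonempty groups is nonnegative — stratum R8 "dependency graph
disconnected" of MASTER-ROUTES §P4 (R3 = `IndependentSplitting`, a group of size one, is the case `|J| = 1`).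
MECHANISM.  `sahiE_nonneg_of_one_slots` — **constant-one slots cost nothing**: for a probability weight, a family with `|O|` slots `≡ 1` and the others
nonnegative monotone has `E_L ≥ 0` as soon as the law is Sahi-positive of the orders `≤ L − |O|` (branching `E_{m+2}(1, g) = m·E_{m+1}(g)`,
`sahiE_succ_succ_of_head_eq_one`, after moving the slot to the head, `SahiMeetTowerAll.sahiE_update_eq_sahiE_cons`).  In the tensor expansion
`E^{μ⊗ν}(φ⊗ψ) = Σ_π [Π_B E^μ(φ_B)]·E^ν_{|π|}(Π_{i∈B}ψ_i)` of a block family the `μ`-side sub-family `φ_B` has its `J`-slots `≡ 1` (at most `|I|` others) and the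
`ν`-side family has the slots of the blocks `B ⊆ I` equal to `1` (at most `|J|` others, one `J`-element per block, blocks being disjoint).
No named facts; nothing conjectural. [this work]
-/

noncomputable section

namespace Summit.CriticalPhenomena.PercolationContinuityZ3.Theorems

open Finset Function
open Literature.Combinatorics.Sahi2008
open Literature.Combinatorics.Sahi2008.PartitionForm

namespace SahiTotalCumulance

variable {γ β : Type*} [Fintype γ] [Fintype β]

/-! ### Constant-one slots cost nothing -/

omit [Fintype γ] in
/-- The positions (after deleting slot `i`) of the members of `O`. [this work] -/
theorem card_le_succ_card_filter_succAbove {L : ℕ} (O : Finset (Fin (L + 1))) (i : Fin (L + 1)) :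
    O.card ≤ (univ.filter fun j : Fin L => i.succAbove j ∈ O).card + 1 := by
  classical
  have hsub : O ⊆ insert i ((univ.filter fun j : Fin L => i.succAbove j ∈ O).map (Fin.succAboveEmb i)) := by
    intro x hx
    rw [mem_insert]
    by_cases hxi : x = i
    · exact Or.inl hxi
    · right
      obtain ⟨z, hz⟩ := Fin.exists_succAbove_eq hxi
      rw [mem_map]
      refine ⟨z, ?_, hz⟩
      rw [mem_filter, hz]
      exact ⟨mem_univ _, hx⟩
  calc O.card ≤ (insert i ((univ.filter fun j : Fin L => i.succAbove j ∈ O).map (Fin.succAboveEmb i))).card :=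
        card_le_card hsub
    _ ≤ ((univ.filter fun j : Fin L => i.succAbove j ∈ O).map (Fin.succAboveEmb i)).card + 1 := card_insert_le _ _
    _ = _ := by rw [card_map]

omit [Fintype γ] in
/-- **Constant-one slots cost nothing.**  For a nonnegative probability weight `ν` on a preorder and a family `G` of `L` slots of which those in
`O` are `≡ 1` and the others nonnegative monotone: if `ν` is Sahi-positive of every order `≤ L − |O|` then `E_L(G) ≥ 0`. [this work] -/
theorem sahiE_nonneg_of_one_slots [Preorder β] (ν : β → ℝ) (hν0 : ∀ y, 0 ≤ ν y) (hν1 : ∑ y, ν y = 1) :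
    ∀ (L : ℕ) (G : Fin L → β → ℝ) (O : Finset (Fin L)),
      (∀ i ∈ O, G i = 1) → (∀ i, i ∉ O → (∀ y, 0 ≤ G i y) ∧ Monotone (G i)) →
      (∀ r ≤ L - O.card, SahiPositive ν r) → 0 ≤ sahiE ν L G
  | 0, G, O, _, _, _ => by rw [sahiE_zero]
  | L + 1, G, O, hO, hG, hpos => by
    classical
    by_cases hO0 : O = ∅
    · subst hO0
      exact hpos (L + 1) (by simp) G (fun i y => (hG i (by simp)).1 y) fun i => (hG i (by simp)).2
    · obtain ⟨i, hi⟩ := Finset.nonempty_iff_ne_empty.2 hO0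
      -- move slot `i` (which is `≡ 1`) to the head
      have hmove : sahiE ν (L + 1) G = sahiE ν (L + 1) (Fin.cons (G i) (i.removeNth G) : Fin (L + 1) → β → ℝ) := by
        have h := SahiMeetTowerAll.sahiE_update_eq_sahiE_cons ν L G i (G i)
        rwa [update_eq_self] at h
      rw [hmove, hO i hi]
      cases L with
      | zero =>
        rw [sahiE_one_apply, Fin.cons_zero, ex_one hν1]
        exact zero_le_one
      | succ m =>
        rw [sahiE_succ_succ_of_head_eq_one hν1 _ (Fin.cons_zero _ _), Fin.tail_cons]
        refine mul_nonneg (Nat.cast_nonneg m) ?_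
        -- induction hypothesis for the family without slot `i`
        refine sahiE_nonneg_of_one_slots ν hν0 hν1 (m + 1) (i.removeNth G)
          (univ.filter fun j : Fin (m + 1) => i.succAbove j ∈ O) (fun j hj => ?_) (fun j hj => ?_) (fun r hr => hpos r ?_)
        · rw [mem_filter] at hj
          exact hO _ hj.2
        · have hj' : i.succAbove j ∉ O := fun h => hj (mem_filter.2 ⟨mem_univ _, h⟩)
          exact hG _ hj'
        · have hc := card_le_succ_card_filter_succAbove O i
          omega

/-! ### The block stratum with sharp orders -/

omit [Fintype β] in
/-- The number of `b`-slots seen through an injective enumeration is at most the number of `b`-slots. [this work] -/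
theorem card_filter_comp_le_of_injective {N k : ℕ} (b : Fin N → Prop) [DecidablePred b] (e : Fin k → Fin N) (he : Injective e) :
    (univ.filter fun j : Fin k => b (e j)).card ≤ (univ.filter b).card := by
  refine card_le_card_of_injOn e (fun j hj => ?_) (fun j _ j' _ h => he h)
  simp only [coe_filter, mem_univ, true_and, Set.mem_setOf_eq] at hj ⊢
  exact hj

/-- **The block stratum, sharp orders.**  Nonnegative probability weights `μ` on a preorder `γ` and `ν` on a preorder `β`; a family of
`n + 1` slots on `γ × β` whose slots with `b i` are `φ_i(x)` and whose other slots are `ψ_i(y)` (`φ_i, ψ_i` nonnegative monotone).  If `μ` is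
Sahi-positive of all orders `≤ |{i : b i}|` and `ν` of all orders `≤ |{i : ¬ b i}|`, then `E^{μ⊗ν}_{n+1} ≥ 0`. [this work] -/
theorem sahiE_prod_blocks_nonneg_sharp [Preorder γ] [Preorder β] (μ : γ → ℝ) (ν : β → ℝ)
    (hμ0 : ∀ x, 0 ≤ μ x) (hμ1 : ∑ x, μ x = 1) (hν0 : ∀ y, 0 ≤ ν y) (hν1 : ∑ y, ν y = 1) (n : ℕ)
    (b : Fin (n + 1) → Prop) [DecidablePred b]
    (hμ : ∀ L ≤ (univ.filter b).card, SahiPositive μ L) (hν : ∀ L ≤ (univ.filter fun i => ¬ b i).card, SahiPositive ν L)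
    (φ : Fin (n + 1) → γ → ℝ) (ψ : Fin (n + 1) → β → ℝ)
    (hφ0 : ∀ i x, 0 ≤ φ i x) (hφm : ∀ i, Monotone (φ i)) (hψ0 : ∀ i y, 0 ≤ ψ i y) (hψm : ∀ i, Monotone (ψ i)) :
    0 ≤ sahiE (fun p : γ × β => μ p.1 * ν p.2) (n + 1) (fun i p => if b i then φ i p.1 else ψ i p.2) := by
  classical
  -- product form
  set φ' : Fin (n + 1) → γ → ℝ := fun i x => if b i then φ i x else 1 with hφ'
  set ψ' : Fin (n + 1) → β → ℝ := fun i y => if b i then (1 : ℝ) else ψ i y with hψ'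
  have hfam : (fun i (p : γ × β) => if b i then φ i p.1 else ψ i p.2) = fun i p => φ' i p.1 * ψ' i p.2 := by
    funext i p
    simp only [hφ', hψ']
    split_ifs <;> simp
  rw [hfam, sahiE_prod_tensor_eq]
  refine sum_nonneg fun c _ => mul_nonneg (prod_nonneg fun m _ => ?_) ?_
  · -- μ-side: the sub-family over block `m`; its `J`-slots are `≡ 1`
    set S := block c m with hS
    refine sahiE_nonneg_of_one_slots μ hμ0 hμ1 S.card (fun j => φ' (S.orderEmbOfFin rfl j))
      (univ.filter fun j => ¬ b (S.orderEmbOfFin rfl j)) (fun j hj => ?_) (fun j hj => ?_) (fun r hr => hμ r ?_)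
    · rw [mem_filter] at hj
      funext x
      simp only [hφ', hj.2, if_false, Pi.one_apply]
    · have hbj : b (S.orderEmbOfFin rfl j) := by
        by_contra h; exact hj (mem_filter.2 ⟨mem_univ _, h⟩)
      refine ⟨fun x => ?_, ?_⟩
      · simp only [hφ', hbj, if_true]; exact hφ0 _ _
      · simp only [hφ', hbj, if_true]; exact hφm _
    · have hsplit := card_filter_add_card_filter_not (s := (univ : Finset (Fin S.card)))
        (fun j => b (S.orderEmbOfFin rfl j))
      have hle := card_filter_comp_le_of_injective b (fun j => S.orderEmbOfFin rfl j) (S.orderEmbOfFin rfl).injective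
      rw [card_univ, Fintype.card_fin] at hsplit
      omega
  · -- ν-side: the family of block products; the blocks inside `I` give slots `≡ 1`
    refine sahiE_nonneg_of_one_slots ν hν0 hν1 c.length
      (fun m y => ∏ j : Fin (block c m).card, ψ' ((block c m).orderEmbOfFin rfl j) y)
      (univ.filter fun m => ∀ j : Fin (block c m).card, b ((block c m).orderEmbOfFin rfl j))
      (fun m hm => ?_) (fun m hm => ?_) (fun r hr => hν r ?_)
    · rw [mem_filter] at hm
      funext y
      simp only [hψ']
      exact prod_eq_one fun j _ => by rw [if_pos (hm.2 j)]
    · refine ⟨fun y => prod_nonneg fun j _ => ?_, ?_⟩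
      · simp only [hψ']; split_ifs; exacts [zero_le_one, hψ0 _ _]
      · refine monotone_prod_of_nonneg univ (fun j => ψ' ((block c m).orderEmbOfFin rfl j)) (fun j y => ?_) fun j => ?_
        · simp only [hψ']; split_ifs; exacts [zero_le_one, hψ0 _ _]
        · by_cases hb : b ((block c m).orderEmbOfFin rfl j)
          · simp only [hψ', hb, if_true]; exact monotone_const
          · simpa [hψ', hb] using hψm _
    · -- each block not inside `I` contains a `J`-slot; distinct blocks give distinct slots
      have hsplit := card_filter_add_card_filter_not (s := (univ : Finset (Fin c.length)))
        (fun m => ∀ j : Fin (block c m).card, b ((block c m).orderEmbOfFin rfl j))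
      rw [card_univ, Fintype.card_fin] at hsplit
      -- choose a `J`-slot in each bad block
      have hchoice : ∀ m ∈ (univ.filter fun m => ¬ ∀ j : Fin (block c m).card, b ((block c m).orderEmbOfFin rfl j)),
          ∃ i : Fin (n + 1), i ∈ block c m ∧ ¬ b i := by
        intro m hm
        rw [mem_filter] at hm
        push Not at hm
        obtain ⟨j, hj⟩ := hm.2
        exact ⟨_, orderEmbOfFin_mem _ _ _, hj⟩
      choose! pick hpick using hchoice
      have hle : (univ.filter fun m => ¬ ∀ j : Fin (block c m).card, b ((block c m).orderEmbOfFin rfl j)).card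
          ≤ (univ.filter fun i => ¬ b i).card := by
        refine card_le_card_of_injOn pick (fun m hm => ?_) (fun m hm m' hm' h => ?_)
        · simp only [coe_filter, mem_univ, true_and, Set.mem_setOf_eq]
          exact (hpick m hm).2
        · have h1 := index_eq_of_mem_block c (hpick m hm).1
          have h2 := index_eq_of_mem_block c (hpick m' hm').1
          rw [← h1, ← h2, h]
      omega

end SahiTotalCumulance

end Summit.CriticalPhenomena.PercolationContinuityZ3.Theorems

end
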